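import Mathlib
import Literature.MathematicalPhysics.QuantumLattice.TorusShellCountUniform
import Literature.MathematicalPhysics.QuantumLattice.HubbardFreeCovariance

/-!
# Dirichlet block levels inside the torus band: the four-fold embedding, the grand-canonical
# comparison and the uniform shell count

Topic `MathematicalPhysics/QuantumLattice` (family `hubbard`). The one-body levels of the FREE
(Dirichlet) `R × R` block of the square lattice are `ε_j = -2 Σ_i cos(π (j_i + 1)/(R + 1))`,
`j ∈ [0,R)²` — i.e. values of the TORUS band of side `2R + 2` at the momenta `(j₁ + 1, j₂ + 1)`:
`ε_j = torusBand (2R+2) (blockMomentum R j)` (this file only uses the latter expression; that these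
are the eigenvalues of the block adjacency is the discrete sine transform, proved elsewhere). We prove
the two facts about these levels that a LOCAL kinetic-budget argument needs, both by embedding the
block momenta into the torus `(ℤ/(2R+2)ℤ)²`:

* `blockMomentumSigned_injective` — the four reflected copies `(±(j₁+1), ±(j₂+1))` of the block
  momenta are pairwise distinct torus momenta, all with the same band value
  (`torusBand_blockMomentumSigned`);
* `gcBandSum_le_four_mul_blockSum` — hence the **grand-canonical comparison**
  `Σ_{k ∈ (ℤ/(2R+2)ℤ)²} min(ε_{2R+2}(k) - μ, 0) ≤ 4 · Σ_{j ∈ [0,R)²} min(ε_j - μ, 0)` for every `μ`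
  (the torus sum runs over a superset of the four copies and its terms are `≤ 0`);
* `card_blockShell_le` — and the **uniform shell count** for block levels:
  `#{j ∈ [0,R)² : |ε_j - μ| ≤ η} ≤ √η (2R+2)² + 2(2R+2)` for every level `μ` and width `η`
  (from `card_torusShell_le_sqrt`, uniform in `μ`).

Folklore (method of images for the discrete Dirichlet Laplacian); no named fact is introduced. Two
auxiliary plain functions are defined (`blockMomentum R j = (j₁+1, j₂+1) ∈ (ℤ/(2R+2)ℤ)²` and its
reflected copies `blockMomentumSigned`), used by the sibling files on the Dirichlet sine basis and the
local kinetic budget. Tree: `torusBand`, `latticeMomentum`, `cos_latticeMomentum_neg`,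
`card_torusShell_le_sqrt`.
-/

namespace Literature.MathematicalPhysics.QuantumLattice

open Finset Literature.Probability.LatticeModels

noncomputable section

variable (R : ℕ)

/-- The block momentum `j ↦ (j₁ + 1, j₂ + 1)` in the torus of side `2R + 2`. [folklore] -/
def blockMomentum (j : Fin 2 → Fin R) : TorusSite 2 (2 * R + 2) :=
  fun i => (((j i : ℕ) + 1 : ℕ) : ZMod (2 * R + 2))

/-- The four reflected copies `(±(j₁+1), ±(j₂+1))` of a block momentum. [folklore] -/
def blockMomentumSigned (s : Fin 2 → Bool) (j : Fin 2 → Fin R) : TorusSite 2 (2 * R + 2) :=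
  fun i => if s i then blockMomentum R j i else -blockMomentum R j i

/-- Coordinates of the block momentum: `(j_i + 1)`. [folklore] -/
theorem blockMomentum_val (j : Fin 2 → Fin R) (i : Fin 2) :
    (blockMomentum R j i).val = (j i : ℕ) + 1 := by
  simp only [blockMomentum, ZMod.val_natCast]
  exact Nat.mod_eq_of_lt (by have := (j i).isLt; omega)

/-- Block momenta have nonzero coordinates. [folklore] -/
theorem blockMomentum_ne_zero (j : Fin 2 → Fin R) (i : Fin 2) : blockMomentum R j i ≠ 0 := by
  intro h
  have h1 := congrArg ZMod.val h
  rw [blockMomentum_val, ZMod.val_zero] at h1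
  omega

/-- Coordinates of the reflected copies: `j_i + 1` or `2R + 2 - (j_i + 1)`. [folklore] -/
theorem blockMomentumSigned_val (s : Fin 2 → Bool) (j : Fin 2 → Fin R) (i : Fin 2) :
    (blockMomentumSigned R s j i).val =
      if s i then (j i : ℕ) + 1 else 2 * R + 2 - ((j i : ℕ) + 1) := by
  unfold blockMomentumSigned
  split_ifs with h
  · exact blockMomentum_val R j i
  · rw [ZMod.neg_val, if_neg (blockMomentum_ne_zero R j i), blockMomentum_val]

/-- The band value of a reflected copy does not depend on the signs. [folklore] -/
theorem torusBand_blockMomentumSigned (s : Fin 2 → Bool) (j : Fin 2 → Fin R) :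
    torusBand (2 * R + 2) (blockMomentumSigned R s j) = torusBand (2 * R + 2) (blockMomentum R j) := by
  unfold torusBand
  congr 1
  refine Finset.sum_congr rfl fun i _ => ?_
  have hcoord : ∀ (k k' : TorusSite 2 (2 * R + 2)) (i : Fin 2), k i = k' i →
      Real.cos (latticeMomentum (2 * R + 2) k i) = Real.cos (latticeMomentum (2 * R + 2) k' i) := by
    intro k k' i h
    simp only [latticeMomentum, h]
  by_cases hs : s i
  · exact hcoord _ _ i (by simp [blockMomentumSigned, hs])
  · rw [hcoord (blockMomentumSigned R s j) (-blockMomentum R j) i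
      (by simp [blockMomentumSigned, hs]), cos_latticeMomentum_neg]

/-- The four reflected copies of the block momenta are pairwise distinct torus momenta. [folklore] -/
theorem blockMomentumSigned_injective :
    Function.Injective (fun p : (Fin 2 → Bool) × (Fin 2 → Fin R) =>
      blockMomentumSigned R p.1 p.2) := by
  rintro ⟨s, j⟩ ⟨s', j'⟩ h
  have hi : ∀ i, (blockMomentumSigned R s j i).val = (blockMomentumSigned R s' j' i).val := fun i => by
    have := congrFun h i
    simp only at this
    rw [this]
  have hsj : ∀ i, s i = s' i ∧ (j i : ℕ) = j' i := by
    intro i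
    have h1 := hi i
    rw [blockMomentumSigned_val, blockMomentumSigned_val] at h1
    have hj := (j i).isLt
    have hj' := (j' i).isLt
    by_cases hs : s i = true
    · by_cases hs' : s' i = true
      · rw [if_pos hs, if_pos hs'] at h1
        exact ⟨by rw [hs, hs'], by omega⟩
      · rw [if_pos hs, if_neg hs'] at h1
        exfalso
        omega
    · by_cases hs' : s' i = true
      · rw [if_neg hs, if_pos hs'] at h1
        exfalso
        omega
      · rw [if_neg hs, if_neg hs'] at h1
        simp only [Bool.not_eq_true] at hs hs'
        exact ⟨by rw [hs, hs'], by omega⟩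
  refine Prod.ext (funext fun i => (hsj i).1) (funext fun i => Fin.ext (hsj i).2)

/-- **Grand-canonical comparison of block and torus levels**: for every `μ`,
`Σ_{k ∈ (ℤ/(2R+2)ℤ)²} min(ε_{2R+2}(k) - μ, 0) ≤ 4 Σ_{j ∈ [0,R)²} min(ε_j - μ, 0)`,
`ε_j = torusBand (2R+2) (blockMomentum R j)`. [folklore] -/
theorem gcBandSum_le_four_mul_blockSum (μ : ℝ) :
    ∑ k : TorusSite 2 (2 * R + 2), min (torusBand (2 * R + 2) k - μ) 0 ≤
      4 * ∑ j : Fin 2 → Fin R, min (torusBand (2 * R + 2) (blockMomentum R j) - μ) 0 := by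
  classical
  set f : TorusSite 2 (2 * R + 2) → ℝ := fun k => min (torusBand (2 * R + 2) k - μ) 0 with hf
  have hf0 : ∀ k, f k ≤ 0 := fun k => min_le_right _ _
  set S : Finset (TorusSite 2 (2 * R + 2)) :=
    (Finset.univ : Finset ((Fin 2 → Bool) × (Fin 2 → Fin R))).image
      (fun p => blockMomentumSigned R p.1 p.2) with hS
  -- the torus sum is at most the sum over the image (nonpositive terms)
  have h1 : ∑ k, f k ≤ ∑ k ∈ S, f k := by
    rw [← Finset.sum_sdiff (Finset.subset_univ S)]
    have : ∑ k ∈ Finset.univ \ S, f k ≤ 0 := Finset.sum_nonpos fun k _ => hf0 k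
    linarith
  -- the sum over the image is the sum over the four copies
  have h2 : ∑ k ∈ S, f k = ∑ p : (Fin 2 → Bool) × (Fin 2 → Fin R),
      f (blockMomentumSigned R p.1 p.2) := by
    rw [hS, Finset.sum_image]
    intro p _ q _ hpq
    exact blockMomentumSigned_injective R hpq
  have h3 : ∑ p : (Fin 2 → Bool) × (Fin 2 → Fin R), f (blockMomentumSigned R p.1 p.2) =
      4 * ∑ j : Fin 2 → Fin R, f (blockMomentum R j) := by
    rw [Fintype.sum_prod_type]
    simp only [hf, torusBand_blockMomentumSigned]
    rw [Finset.sum_const, Finset.card_univ, Fintype.card_fun, Fintype.card_bool, Fintype.card_fin,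
      nsmul_eq_mul]
    norm_num
  calc ∑ k, f k ≤ ∑ k ∈ S, f k := h1
    _ = _ := h2
    _ = _ := h3

/-- **Uniform shell count for block levels**: for every level `μ` and width `η`,
`#{j ∈ [0,R)² : |ε_j - μ| ≤ η} ≤ √η (2R+2)² + 2(2R+2)`. [folklore] -/
theorem card_blockShell_le (μ η : ℝ) :
    ((univ.filter fun j : Fin 2 → Fin R =>
        |torusBand (2 * R + 2) (blockMomentum R j) - μ| ≤ η).card : ℝ) ≤
      Real.sqrt η * ((2 * R + 2 : ℕ) : ℝ) ^ 2 + 2 * ((2 * R + 2 : ℕ) : ℝ) := by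
  classical
  have hinj : Function.Injective (blockMomentum R) := by
    intro j j' h
    have := blockMomentumSigned_injective R
      (a₁ := (fun _ => true, j)) (a₂ := (fun _ => true, j')) (by
        funext i; simp [blockMomentumSigned, h])
    exact (Prod.ext_iff.1 this).2
  have hcard : (univ.filter fun j : Fin 2 → Fin R =>
        |torusBand (2 * R + 2) (blockMomentum R j) - μ| ≤ η).card ≤
      (univ.filter fun k : TorusSite 2 (2 * R + 2) => |torusBand (2 * R + 2) k - μ| ≤ η).card := by
    rw [← Finset.card_image_of_injective _ hinj]
    refine Finset.card_le_card fun k hk => ?_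
    simp only [Finset.mem_image, Finset.mem_filter, Finset.mem_univ, true_and] at hk ⊢
    obtain ⟨j, hj, rfl⟩ := hk
    exact hj
  exact (Nat.cast_le.2 hcard).trans (card_torusShell_le_sqrt μ η)

end

end Literature.MathematicalPhysics.QuantumLattice
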